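import Summits.QuantumFields.YangMills.Theorems.LuscherReductionTwistedTraceScalingFloorSubsolution
import HarnessLib

/-!
# The k = 0 FLOOR from the pointwise sub-solution bound: transport to the whole tube, the Rayleigh door with a remainder, and the two mass bounds
# (lane A of S-BASE, crux `TwistedTraceScaling` stmt-QuantumFields-20203; design note `pub/ym-fleet/ym-luscher-20007-p1/COARSE-DESIGN.md` §18)

With `ψ = floorTrial β μ γ` (`…FloorTube`) and the pointwise bound `(K_β ψ)(W) ≥ m·ψ(W) − r` at near-vacuum steps (`floor_subsolution_near`, `…FloorSubsolution`):
* §1 `floor_subsolution_tube` — the bound holds at EVERY `U` with `d_tor U ≤ τ` (gauge × twist transport: `ψ` and `K_β ψ` are physical);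
* §2 `mul_setIntegral_sq_sub_le_levelValue_zero_mul_l2` — the Rayleigh DOOR with a remainder: `ψ` physical, `0 ≤ ψ ≤ 1`, `(K_βψ)(U) ≥ mψ(U) − r` on a measurable `B`
  (`r ≥ 0`) ⇒ `m·∫_B ψ² − r ≤ λ₀(β,L)·‖ψ‖²`;
* §3 `setIntegral_sq_floorTrial_ge` — mass off the tube is tiny: `∫_{d_tor ≤ τ} ψ² ≥ ‖ψ‖² − e^{−2γτ²}` (`ψ ≤ G ≤ e^{−γτ²}` there, probability measure);
* §4 `floorMass`, ★ `l2_floorTrial_ge` — mass near the vacuum is not too small: `‖ψ‖² ≥ floorMass = ((2s)³·(2π²)⁻¹(1+3s²)⁻²)^{|E|}·e^{−2ĝσ(s)}·e^{−2γ δ₁(√3 s)²}`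
  for any `0 < s ≤ 1/30` (the vacuum-pattern chart cube `[−s,s]^{3|E|}`: `…LatticeGnChart.integral_configMeasure_eq_sum_latPatternChart`, `gnoWeight_ge_of_mem_cube`);
* §5 ★★★ `levelValue_zero_ge_floor` — `λ₀(β,L) ≥ m − (m·e^{−2γτ²} + r)/floorMass`, `m = floorCK·e^{−riccatiTrialErr}·e^{−γ(2τδ₁+δ₁²)}·e^{−floorDefect}·√(π/β)^{3|E|}·e^{−6Z₀(1/2)}`,
  `r = floorCK·floorTail` — the floor before the choice of scales (`…FloorAssembly` takes `ρ² = C log β/β`, `τ = β^{−1/3}`, `γ = C' log β·β^{2/3}`, `s = β^{−1/2}`).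
HONEST FRAMING: fixed-lattice bookkeeping for a stub lane of a child of the CONDITIONAL reduction route (femto rung R2b1); not infinite volume, not a gap, not Clay.

## References
* M. Lüscher, Nucl. Phys. B219 (1983) 233, §3. [Luscher1983]
* M. Reed, B. Simon, *Methods of Modern Mathematical Physics IV* (1978), Thm XIII.1. [ReedSimonIV1978]
-/

set_option autoImplicit false

noncomputable section

open MeasureTheory Real Finset
open scoped BigOperators RealInnerProductSpace
open Literature.MathematicalPhysics.QuantumFieldTheory
open Literature.MathematicalPhysics.QuantumLattice
open Literature.MathematicalPhysics.QuantumFieldTheory.Balaban1983to89.T4CubePoincare (cube mem_cube_iff measurableSet_cube')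
open Literature.MathematicalPhysics.QuantumFieldTheory.Balaban1983to89.T4CubeChartGnomonic (gnoPoint gnoWeight gnoWeight_ge_of_mem_cube volume_cube₃_toReal)

namespace Summit.QuantumFields.YangMills.Theorems.FemtoTransferGap

open TwoLattice TwoLattice.Toron TwoLattice.Cov TwoLattice.Stiff TwoLattice.Harm TwoLattice.GnChart TwoLattice.Flat TwoLattice.Lower

variable {L : ℕ} [NeZero L]

/-! ## §1 Transport of the pointwise bound to the whole tube -/

/-- ★ **The sub-solution bound on the whole tube** `{d_tor ≤ τ}` (`τ ≤ 1/30`): every such `U` is gauge × twist equivalent to a near-vacuum step, and both `ψ` and `K_β ψ`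
are physical. [cite: Luscher1983, §3] -/
theorem floor_subsolution_tube (hL : 2 ≤ L) {β μ γ ρ δ τ : ℝ} (hβ : 0 < β) (hμ : 0 < μ) (hγ : 0 ≤ γ) (hδ : δ < 1) (hρ0 : 0 ≤ ρ)
    (hρ : ρ ≤ 1 / 100) (hρδ : (1 - δ) ^ 2 * (1 + ρ ^ 2) ≤ 1) (hτ : τ ≤ 1 / 30) (hσ : tubeSigma L τ ≤ 1 / 16)
    (hgap : 2 * (Real.sqrt μ + 504 * τ * Real.sqrt (Fintype.card (Plaquette 3 L × Fin 3))) ^ 2 ≤ 2 - 2 * Real.cos (2 * Real.pi / L))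
    (U : GaugeConfig 3 L SU2) (hU : torDist U ≤ τ) :
    floorCK L β ρ τ * (Real.exp (-riccatiTrialErr L β μ ρ (tubeSigma L τ)) * Real.exp (-(γ * (2 * τ * chartMove L ρ + chartMove L ρ ^ 2))) *
        Real.exp (-floorDefect L β μ τ) * (Real.sqrt (Real.pi / β) ^ (Fintype.card (Edge 3 L) * 3) * Real.exp (-(6 * toronZPE L (1 / 2) 0 0))) *
        floorTrial β μ γ U) - floorCK L β ρ τ * floorTail L β ρ
      ≤ transferApply β (floorTrial β μ γ) U := by
  have hψ : IsPhys (floorTrial (L := L) β μ γ) := isPhys_floorTrial β hμ hγ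
  have hKψ : IsPhys (transferApply (L := L) β (floorTrial β μ γ)) := isPhys_transferApply β hψ
  obtain ⟨z, hz⟩ := exists_torDist_eq U
  have hU' : orbitDist (TT.twist3 z U) ≤ τ := by rw [← hz]; exact hU
  obtain ⟨g, hs, hw⟩ := exists_near_of_orbitDist_le (TT.twist3 z U) hU' (by linarith)
  set W := gaugeTransform g (TT.twist3 z U) with hW
  have hWd : torDist W ≤ τ := by rw [hW, torDist_gaugeTransform, torDist_twist3]; exact hU
  have h := floor_subsolution_near hL hβ hμ hγ hδ hρ0 hρ hρδ hτ hs hw hσ hgap hWd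
  have hψW : floorTrial β μ γ W = floorTrial β μ γ U := by rw [hW, hψ.gaugeInv, TT.twist3_eq_of_isPhys hψ]
  have hKW : transferApply β (floorTrial β μ γ) W = transferApply β (floorTrial β μ γ) U := by
    rw [hW, hKψ.gaugeInv, TT.twist3_eq_of_isPhys hKψ]
  rw [hψW, hKW] at h
  exact h

/-! ## §2 The Rayleigh door with a remainder -/

/-- ★ **DOOR WITH A REMAINDER.**  `ψ` physical, `0 ≤ ψ ≤ 1`, `B` measurable, `r ≥ 0`, `(K_β ψ)(U) ≥ m·ψ(U) − r` on `B`: then `m·∫_B ψ² − r ≤ λ₀(β,L)·‖ψ‖²`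
(`∫_B ψ·K_βψ ≥ m∫_B ψ² − r∫_B ψ ≥ m∫_Bψ² − r` on a probability space, and `∫_B ψK_βψ ≤ ⟨ψ,K_βψ⟩ ≤ λ₀‖ψ‖²`). [cite: ReedSimonIV1978, Thm. XIII.1] -/
theorem mul_setIntegral_sq_sub_le_levelValue_zero_mul_l2 (β : ℝ) {ψ : GaugeConfig 3 L SU2 → ℝ} (hψ : IsPhys ψ) (hψ0 : ∀ U, 0 ≤ ψ U)
    (hψ1 : ∀ U, ψ U ≤ 1) {B : Set (GaugeConfig 3 L SU2)} (hB : MeasurableSet B) {m r : ℝ} (hr : 0 ≤ r)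
    (hm : ∀ U ∈ B, m * ψ U - r ≤ transferApply β ψ U) :
    m * ∫ U in B, ψ U ^ 2 ∂configMeasure SU2 L - r ≤ levelValue su2Rep L β 0 * l2 ψ ψ := by
  haveI : SecondCountableTopology SU2 := secondCountableTopology_su2
  obtain ⟨C, hC⟩ := hψ.bounded
  obtain ⟨M, hM⟩ := exists_transferKernel_le su2Rep continuous_su2Rep β (L := L)
  have hKψm : Measurable (transferApply (L := L) β ψ) := measurable_transferApply β hψ.measurable
  have hKψb : ∀ U, |transferApply β ψ U| ≤ M * C := abs_transferApply_le β hM hψ.measurable hC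
  have hK0 : ∀ U, 0 ≤ transferApply β ψ U := transferApply_nonneg β hψ0
  have hC0 : 0 ≤ C := (abs_nonneg _).trans (hC (fun _ => 1))
  have hint : Integrable (fun U => ψ U * transferApply β ψ U) (configMeasure SU2 L) := by
    refine Integrable.mono' (integrable_const (C * (M * C))) ((hψ.measurable.mul hKψm).aestronglyMeasurable) (ae_of_all _ fun U => ?_)
    rw [Real.norm_eq_abs, abs_mul]
    exact mul_le_mul (hC U) (hKψb U) (abs_nonneg _) hC0
  have hint2 : Integrable (fun U => ψ U ^ 2) (configMeasure SU2 L) := by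
    refine Integrable.mono' (integrable_const (C * C)) ((hψ.measurable.pow_const 2).aestronglyMeasurable) (ae_of_all _ fun U => ?_)
    rw [Real.norm_eq_abs, abs_pow, pow_two]
    exact mul_le_mul (hC U) (hC U) (abs_nonneg _) hC0
  have hint1 : Integrable ψ (configMeasure SU2 L) :=
    Integrable.mono' (integrable_const C) hψ.measurable.aestronglyMeasurable (ae_of_all _ fun U => by rw [Real.norm_eq_abs]; exact hC U)
  -- `m ∫_B ψ² − r ∫_B ψ ≤ ∫_B ψ·Kψ`
  have h1 : m * ∫ U in B, ψ U ^ 2 ∂configMeasure SU2 L - r * ∫ U in B, ψ U ∂configMeasure SU2 L ≤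
      ∫ U in B, ψ U * transferApply β ψ U ∂configMeasure SU2 L := by
    rw [← integral_const_mul, ← integral_const_mul, ← integral_sub ((hint2.const_mul m).integrableOn) ((hint1.const_mul r).integrableOn)]
    refine setIntegral_mono_on (((hint2.const_mul m).sub (hint1.const_mul r)).integrableOn) hint.integrableOn hB fun U hU => ?_
    have := mul_le_mul_of_nonneg_left (hm U hU) (hψ0 U)
    nlinarith [hψ0 U, hψ1 U]
  -- `∫_B ψ ≤ 1`
  have h1' : ∫ U in B, ψ U ∂configMeasure SU2 L ≤ 1 := by
    calc ∫ U in B, ψ U ∂configMeasure SU2 L ≤ ∫ U, ψ U ∂configMeasure SU2 L := setIntegral_le_integral hint1 (ae_of_all _ hψ0)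
      _ ≤ ∫ _U, (1 : ℝ) ∂configMeasure SU2 L := integral_mono hint1 (integrable_const 1) hψ1
      _ = 1 := by simp
  have h2 : ∫ U in B, ψ U * transferApply β ψ U ∂configMeasure SU2 L ≤ ∫ U, ψ U * transferApply β ψ U ∂configMeasure SU2 L :=
    setIntegral_le_integral hint (ae_of_all _ fun U => mul_nonneg (hψ0 U) (hK0 U))
  have h3 : ∫ U, ψ U * transferApply β ψ U ∂configMeasure SU2 L = qform su2Rep β ψ ψ := by
    rw [qform_eq_l2_transferApply]; rfl
  have hl2 : l2 ψ ψ = ∫ U, ψ U ^ 2 ∂configMeasure SU2 L := by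
    unfold l2; exact integral_congr_ae (ae_of_all _ fun U => by ring)
  by_cases hl : 0 < l2 ψ ψ
  · have hq := qform_le_levelValue_zero_mul su2Rep continuous_su2Rep β hψ hl
    nlinarith [mul_le_mul_of_nonneg_left h1' hr]
  · -- `‖ψ‖² = 0`: then `∫_B ψ² = 0`
    have hl0 : l2 ψ ψ = 0 := le_antisymm (not_lt.1 hl) (l2_self_nonneg ψ)
    have hB0 : ∫ U in B, ψ U ^ 2 ∂configMeasure SU2 L ≤ ∫ U, ψ U ^ 2 ∂configMeasure SU2 L :=
      setIntegral_le_integral hint2 (ae_of_all _ fun U => sq_nonneg _)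
    have hBn : 0 ≤ ∫ U in B, ψ U ^ 2 ∂configMeasure SU2 L := integral_nonneg fun U => sq_nonneg _
    rw [← hl2, hl0] at hB0
    have hz : ∫ U in B, ψ U ^ 2 ∂configMeasure SU2 L = 0 := le_antisymm hB0 hBn
    rw [hz, hl0, mul_zero, mul_zero]; linarith

/-! ## §3 The mass off the tube -/

/-- The tube `{d_tor ≤ τ}` is measurable. [folklore] -/
theorem measurableSet_torDist_le (τ : ℝ) : MeasurableSet {U : GaugeConfig 3 L SU2 | torDist U ≤ τ} :=
  measurableSet_le measurable_torDist measurable_const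

/-- ★ **Mass off the tube is tiny**: `∫_{d_tor ≤ τ} ψ² ≥ ‖ψ‖² − e^{−2γτ²}` (`ψ ≤ G ≤ e^{−γτ²}` off the tube; probability measure; `γ, τ ≥ 0`, `μ > 0`).
[cite: Luscher1983, §3] -/
theorem setIntegral_sq_floorTrial_ge {β μ γ τ : ℝ} (hμ : 0 < μ) (hγ : 0 ≤ γ) (hτ : 0 ≤ τ) :
    l2 (floorTrial (L := L) β μ γ) (floorTrial β μ γ) - Real.exp (-(2 * γ * τ ^ 2)) ≤
      ∫ U in {U : GaugeConfig 3 L SU2 | torDist U ≤ τ}, floorTrial β μ γ U ^ 2 ∂configMeasure SU2 L := by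
  set ψ := floorTrial (L := L) β μ γ with hψ
  have hphys : IsPhys ψ := isPhys_floorTrial β hμ hγ
  have hint2 : Integrable (fun U => ψ U ^ 2) (configMeasure SU2 L) := by
    refine Integrable.mono' (integrable_const 1) ((hphys.measurable.pow_const 2).aestronglyMeasurable) (ae_of_all _ fun U => ?_)
    rw [Real.norm_eq_abs, abs_pow, abs_of_pos (floorTrial_pos β μ γ U)]
    exact pow_le_one₀ (floorTrial_pos β μ γ U).le (floorTrial_le_one hμ hγ U)
  have hl2 : l2 ψ ψ = ∫ U, ψ U ^ 2 ∂configMeasure SU2 L := by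
    unfold l2; exact integral_congr_ae (ae_of_all _ fun U => by ring)
  have hsplit := integral_add_compl (μ := configMeasure SU2 L) (measurableSet_torDist_le (L := L) τ) hint2
  -- off the tube: `ψ² ≤ e^{−2γτ²}`
  have hoff : ∫ U in {U : GaugeConfig 3 L SU2 | torDist U ≤ τ}ᶜ, ψ U ^ 2 ∂configMeasure SU2 L ≤ Real.exp (-(2 * γ * τ ^ 2)) := by
    have hpt : ∀ U ∈ {U : GaugeConfig 3 L SU2 | torDist U ≤ τ}ᶜ, ψ U ^ 2 ≤ Real.exp (-(2 * γ * τ ^ 2)) := by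
      intro U hU
      have hU' : τ ≤ torDist U := le_of_lt (not_le.mp hU)
      have hG := floorCutoff_le_exp hγ hτ U hU'
      have hψle : ψ U ≤ Real.exp (-(γ * τ ^ 2)) := by
        rw [hψ]; unfold floorTrial
        calc stiffTrial (riccatiWeight (β / 2) β μ) U * floorCutoff γ U ≤ 1 * Real.exp (-(γ * τ ^ 2)) :=
              mul_le_mul (stiffTrial_le_one (fun s => riccatiWeight_nonneg hμ s) U) hG (floorCutoff_pos γ U).le zero_le_one
          _ = _ := one_mul _
      have h2 : Real.exp (-(2 * γ * τ ^ 2)) = Real.exp (-(γ * τ ^ 2)) ^ 2 := by rw [← Real.exp_nat_mul]; congr 1; push_cast; ring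
      rw [h2]
      exact pow_le_pow_left₀ (floorTrial_pos β μ γ U).le hψle 2
    calc ∫ U in {U : GaugeConfig 3 L SU2 | torDist U ≤ τ}ᶜ, ψ U ^ 2 ∂configMeasure SU2 L
        ≤ ∫ _U in {U : GaugeConfig 3 L SU2 | torDist U ≤ τ}ᶜ, Real.exp (-(2 * γ * τ ^ 2)) ∂configMeasure SU2 L :=
          setIntegral_mono_on hint2.integrableOn (integrable_const _).integrableOn (measurableSet_torDist_le (L := L) τ).compl hpt
      _ ≤ Real.exp (-(2 * γ * τ ^ 2)) := by
          rw [setIntegral_const, smul_eq_mul]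
          exact mul_le_of_le_one_left (Real.exp_pos _).le measureReal_le_one
  rw [hl2, ← hsplit]
  linarith

/-! ## §4 The mass near the vacuum -/

variable (L) in
/-- **The floor's mass bound** at cube size `s`: `((2s)³·(2π²)⁻¹(1+3s²)⁻²)^{|E|}·e^{−2ĝ·σ(s)}·e^{−2γ·δ₁(√3 s)²}`, `ĝ = √((β/2)² + β²/μ)` — a lower bound for `‖ψ‖²` from
the vacuum-pattern chart cube `[−s, s]^{3|E|}`. [cite: Luscher1983, §3] -/
def floorMass (β μ γ s : ℝ) : ℝ :=
  ((2 * s) ^ 3 * ((2 * π ^ 2)⁻¹ * ((1 + 3 * s ^ 2)⁻¹) ^ 2)) ^ Fintype.card (Edge 3 L) *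
    (Real.exp (-(Real.sqrt ((β / 2) ^ 2 + 2 * (β / 2) * β / μ) * tubeSigma L s)) ^ 2 * Real.exp (-(γ * chartMove L (Real.sqrt 3 * s) ^ 2)) ^ 2)

/-- `floorMass > 0` for `s > 0`. [folklore] -/
theorem floorMass_pos (β μ γ : ℝ) {s : ℝ} (hs : 0 < s) : 0 < floorMass L β μ γ s := by
  unfold floorMass; positivity

/-- On the vacuum-pattern chart cube `[−s,s]^{3|E|}` (`0 < s ≤ 1/30`) the trial state is bounded below:
`ψ(P y) ≥ e^{−ĝσ(s)}·e^{−γ δ₁(√3 s)²}`. [cite: Luscher1983, §3] -/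
theorem floorTrial_chart_ge {β μ γ s : ℝ} (hβ : 0 < β) (hμ : 0 < μ) (hγ : 0 ≤ γ) (hs0 : 0 ≤ s) (hs : s ≤ 1 / 30)
    (y : Edge 3 L → Fin 3 → ℝ) (hy : ∀ e, y e ∈ cube 3 s) :
    Real.exp (-(Real.sqrt ((β / 2) ^ 2 + 2 * (β / 2) * β / μ) * tubeSigma L s)) * Real.exp (-(γ * chartMove L (Real.sqrt 3 * s) ^ 2)) ≤
      floorTrial β μ γ (latPatternChart L (fun _ => false) y) := by
  set W := latPatternChart L (fun _ => false) y with hW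
  -- `W` is a near-vacuum step of size `s`
  have hsW : ∀ e : Edge 3 L, 0 ≤ scalarPart (W e) := fun e => by
    rw [hW, latPatternChart_false]; exact (gnoPoint_chart (y e)).1.le
  have hwW : ∀ (e : Edge 3 L) (c : Fin 3), |vecPart (W e) c| ≤ s := by
    intro e c
    rw [hW, latPatternChart_false, (gnoPoint_chart (y e)).2.2 c, abs_mul, abs_of_pos (gnoPoint_chart (y e)).1]
    have h1 : scalarPart (gnoPoint (y e)) ≤ 1 := by
      have := abs_scalarPart_le (gnoPoint (y e)); rw [abs_le] at this; exact this.2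
    have h2 : |y e c| ≤ s := (mem_cube_iff.mp (hy e)) c
    calc scalarPart (gnoPoint (y e)) * |y e c| ≤ 1 * s := mul_le_mul h1 h2 (abs_nonneg _) zero_le_one
      _ = s := one_mul _
  -- `H(W) ≥ e^{−ĝ σ(s)}`
  have hS : wilsonAction su2Rep W ≤ tubeSigma L s := by rw [tubeSigma]; exact wilsonAction_near_vacuum_le hs hsW hwW
  have hH := exp_neg_mul_le_stiffTrial_of_le (t := β / 2) (b := β) (by positivity) hβ.le hμ W hS
  -- `G(W) ≥ e^{−γ δ₁(√3 s)²}`: `d_tor W ≤ orbitDist W ≤ Σ_e ‖W_e − 1‖_F ≤ |E|√2·(√3 s)`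
  have hys : ∀ e, ∑ a, y e a ^ 2 ≤ (Real.sqrt 3 * s) ^ 2 := by
    intro e
    have hi : ∀ a, y e a ^ 2 ≤ s ^ 2 := fun a => by
      have := (mem_cube_iff.mp (hy e)) a
      exact sq_le_sq' (abs_le.mp this).1 (abs_le.mp this).2
    calc ∑ a, y e a ^ 2 ≤ ∑ _a : Fin 3, s ^ 2 := Finset.sum_le_sum fun a _ => hi a
      _ = (Real.sqrt 3 * s) ^ 2 := by
          rw [Finset.sum_const, Finset.card_univ, Fintype.card_fin, mul_pow, Real.sq_sqrt (by norm_num)]; simp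
  have hdist : torDist W ≤ chartMove L (Real.sqrt 3 * s) := by
    refine (torDist_le_orbitDist W).trans ((orbitDist_le 1 W).trans ?_)
    have h1 := sum_fd_chartStep_le (1 : GaugeConfig 3 L SU2) (by positivity) y hys
    rw [mul_one] at h1
    have h2 : gaugeDist 1 W = ∑ e : Edge 3 L, fd (W e) ((1 : GaugeConfig 3 L SU2) e) := by
      simp only [gaugeDist, TT.gaugeTransform_one', Pi.one_apply, ← fd_one]
    rw [h2, chartMove]
    exact h1
  have hG : Real.exp (-(γ * chartMove L (Real.sqrt 3 * s) ^ 2)) ≤ floorCutoff γ W := by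
    unfold floorCutoff
    rw [Real.exp_le_exp, neg_le_neg_iff]
    exact mul_le_mul_of_nonneg_left (pow_le_pow_left₀ (torDist_nonneg W) hdist 2) hγ
  unfold floorTrial
  exact mul_le_mul hH hG (Real.exp_pos _).le (stiffTrial_pos _ _).le

/-- ★ **THE MASS NEAR THE VACUUM**: `‖ψ‖² ≥ floorMass L β μ γ s` for every `0 < s ≤ 1/30` (`β, μ > 0`, `γ ≥ 0`). [cite: Luscher1983, §3] -/
theorem l2_floorTrial_ge {β μ γ s : ℝ} (hβ : 0 < β) (hμ : 0 < μ) (hγ : 0 ≤ γ) (hs0 : 0 < s) (hs : s ≤ 1 / 30) :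
    floorMass L β μ γ s ≤ l2 (floorTrial (L := L) β μ γ) (floorTrial β μ γ) := by
  set ψ := floorTrial (L := L) β μ γ with hψ
  have hphys : IsPhys ψ := isPhys_floorTrial β hμ hγ
  have hl2 : l2 ψ ψ = ∫ U, ψ U ^ 2 ∂configMeasure SU2 L := by
    unfold l2; exact integral_congr_ae (ae_of_all _ fun U => by ring)
  have hmeas2 : Measurable fun U => ψ U ^ 2 := hphys.measurable.pow_const 2
  have hb2 : ∃ C : ℝ, ∀ U, |ψ U ^ 2| ≤ C := ⟨1, fun U => by
    rw [abs_pow, abs_of_pos (floorTrial_pos β μ γ U)]; exact pow_le_one₀ (floorTrial_pos β μ γ U).le (floorTrial_le_one hμ hγ U)⟩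
  rw [hl2, integral_configMeasure_eq_sum_latPatternChart L hmeas2 hb2]
  -- keep the vacuum pattern only
  have hterm0 : ∀ z : Edge 3 L → Bool, 0 ≤ ∫ w, latGnDensityReal L w * ψ (latPatternChart L z w) ^ 2 :=
    fun z => integral_nonneg fun w => mul_nonneg (latGnDensityReal_pos_le L w).1.le (sq_nonneg _)
  refine le_trans ?_ (Finset.single_le_sum (fun z _ => hterm0 z) (Finset.mem_univ (fun _ => false)))
  -- the cube
  set box : Set (Edge 3 L → Fin 3 → ℝ) := Set.pi Set.univ fun _ => cube 3 s with hbox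
  have hbox_meas : MeasurableSet box := MeasurableSet.univ_pi fun _ => measurableSet_cube' 3 s
  set c : ℝ := ((2 * π ^ 2)⁻¹ * ((1 + 3 * s ^ 2)⁻¹) ^ 2) ^ Fintype.card (Edge 3 L) *
    (Real.exp (-(Real.sqrt ((β / 2) ^ 2 + 2 * (β / 2) * β / μ) * tubeSigma L s)) * Real.exp (-(γ * chartMove L (Real.sqrt 3 * s) ^ 2))) ^ 2 with hc
  have hc0 : 0 ≤ c := by positivity
  -- pointwise on the cube
  have hpt : ∀ w, box.indicator (fun _ => c) w ≤ latGnDensityReal L w * ψ (latPatternChart L (fun _ => false) w) ^ 2 := by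
    intro w
    by_cases hw : w ∈ box
    · rw [Set.indicator_of_mem hw]
      have hy : ∀ e, w e ∈ cube 3 s := fun e => Set.mem_univ_pi.mp hw e
      have hdens : ((2 * π ^ 2)⁻¹ * ((1 + 3 * s ^ 2)⁻¹) ^ 2) ^ Fintype.card (Edge 3 L) ≤ latGnDensityReal L w := by
        unfold latGnDensityReal
        rw [← Finset.card_univ, ← Finset.prod_const]
        exact Finset.prod_le_prod (fun e _ => by positivity) fun e _ => gnoWeight_ge_of_mem_cube (hy e)
      have hψw := floorTrial_chart_ge hβ hμ hγ hs0.le hs w hy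
      rw [hc]
      exact mul_le_mul hdens (pow_le_pow_left₀ (by positivity) hψw 2) (by positivity) (latGnDensityReal_pos_le L w).1.le
    · rw [Set.indicator_of_notMem hw]
      exact mul_nonneg (latGnDensityReal_pos_le L w).1.le (sq_nonneg _)
  -- integrability of the chart integrand
  have hint : Integrable (fun w => latGnDensityReal L w * ψ (latPatternChart L (fun _ => false) w) ^ 2) := by
    refine Integrable.mono' (integrable_latGnDensityReal (L := L)) ?_ (ae_of_all _ fun w => ?_)
    · exact ((measurable_latGnDensityReal L).mul (hmeas2.comp (measurable_latPatternChart L _))).aestronglyMeasurable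
    · rw [Real.norm_eq_abs, abs_of_nonneg (mul_nonneg (latGnDensityReal_pos_le L w).1.le (sq_nonneg _))]
      have h1 : ψ (latPatternChart L (fun _ => false) w) ^ 2 ≤ 1 :=
        pow_le_one₀ (floorTrial_pos β μ γ _).le (floorTrial_le_one hμ hγ _)
      calc latGnDensityReal L w * ψ (latPatternChart L (fun _ => false) w) ^ 2 ≤ latGnDensityReal L w * 1 :=
            mul_le_mul_of_nonneg_left h1 (latGnDensityReal_pos_le L w).1.le
        _ = _ := mul_one _
  have hvol : ∫ w, box.indicator (fun _ => c) w = c * (2 * s) ^ (3 * Fintype.card (Edge 3 L)) := by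
    rw [integral_indicator_const c hbox_meas, smul_eq_mul, mul_comm]
    congr 1
    rw [measureReal_def, hbox, volume_pi_pi, ENNReal.toReal_prod]
    simp only [volume_cube₃_toReal hs0.le, Finset.prod_const, Finset.card_univ]
    rw [← pow_mul]
  have hfin : floorMass L β μ γ s = c * (2 * s) ^ (3 * Fintype.card (Edge 3 L)) := by
    rw [floorMass, hc, mul_pow, pow_mul, mul_pow]; ring
  rw [hfin, ← hvol]
  exact integral_mono_of_nonneg (ae_of_all _ fun w => Set.indicator_nonneg (fun _ _ => hc0) w) hint (ae_of_all _ hpt)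

/-! ## §5 ★★★ The floor before the choice of scales -/

/-- ★★★ **THE k = 0 FLOOR, PRE-ASYMPTOTIC FORM.**  For `L ≥ 2`, `β, μ > 0`, `γ ≥ 0`, chart data `0 ≤ ρ ≤ 1/100`, `δ < 1`, `(1−δ)²(1+ρ²) ≤ 1`, tube radius
`0 ≤ τ ≤ 1/30` with `tubeSigma L τ ≤ 1/16` and `2(√μ + 504τ√N)² ≤ 2 − 2cos(2π/L)`, and any cube size `0 < s ≤ 1/30`:
`λ₀(β,L) ≥ m − (m·e^{−2γτ²} + floorCK·floorTail)/floorMass(s)`, `m = floorCK·e^{−riccatiTrialErr}·e^{−γ(2τδ₁+δ₁²)}·e^{−floorDefect}·√(π/β)^{3|E|}·e^{−6·toronZPE L (1/2) 0 0}`.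
[cite: Luscher1983, §3] [cite: ReedSimonIV1978, Thm. XIII.1] -/
theorem levelValue_zero_ge_floor (hL : 2 ≤ L) {β μ γ ρ δ τ s : ℝ} (hβ : 0 < β) (hμ : 0 < μ) (hγ : 0 ≤ γ) (hδ : δ < 1) (hρ0 : 0 ≤ ρ)
    (hρ : ρ ≤ 1 / 100) (hρδ : (1 - δ) ^ 2 * (1 + ρ ^ 2) ≤ 1) (hτ0 : 0 ≤ τ) (hτ : τ ≤ 1 / 30) (hσ : tubeSigma L τ ≤ 1 / 16)
    (hgap : 2 * (Real.sqrt μ + 504 * τ * Real.sqrt (Fintype.card (Plaquette 3 L × Fin 3))) ^ 2 ≤ 2 - 2 * Real.cos (2 * Real.pi / L))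
    (hs0 : 0 < s) (hs : s ≤ 1 / 30) :
    floorCK L β ρ τ * (Real.exp (-riccatiTrialErr L β μ ρ (tubeSigma L τ)) * Real.exp (-(γ * (2 * τ * chartMove L ρ + chartMove L ρ ^ 2))) *
        Real.exp (-floorDefect L β μ τ) * (Real.sqrt (Real.pi / β) ^ (Fintype.card (Edge 3 L) * 3) * Real.exp (-(6 * toronZPE L (1 / 2) 0 0)))) -
      (floorCK L β ρ τ * (Real.exp (-riccatiTrialErr L β μ ρ (tubeSigma L τ)) * Real.exp (-(γ * (2 * τ * chartMove L ρ + chartMove L ρ ^ 2))) *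
        Real.exp (-floorDefect L β μ τ) * (Real.sqrt (Real.pi / β) ^ (Fintype.card (Edge 3 L) * 3) * Real.exp (-(6 * toronZPE L (1 / 2) 0 0)))) *
          Real.exp (-(2 * γ * τ ^ 2)) + floorCK L β ρ τ * floorTail L β ρ) / floorMass L β μ γ s
      ≤ levelValue su2Rep L β 0 := by
  set m : ℝ := floorCK L β ρ τ * (Real.exp (-riccatiTrialErr L β μ ρ (tubeSigma L τ)) * Real.exp (-(γ * (2 * τ * chartMove L ρ + chartMove L ρ ^ 2))) *
    Real.exp (-floorDefect L β μ τ) * (Real.sqrt (Real.pi / β) ^ (Fintype.card (Edge 3 L) * 3) * Real.exp (-(6 * toronZPE L (1 / 2) 0 0)))) with hm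
  set r : ℝ := floorCK L β ρ τ * floorTail L β ρ with hr
  set M : ℝ := floorMass L β μ γ s with hM
  set ψ := floorTrial (L := L) β μ γ with hψ
  set B : Set (GaugeConfig 3 L SU2) := {U | torDist U ≤ τ} with hB
  have hphys : IsPhys ψ := isPhys_floorTrial β hμ hγ
  have hm0 : 0 ≤ m := by rw [hm]; exact mul_nonneg (floorCK_nonneg β ρ τ) (by positivity)
  have hr0 : 0 ≤ r := mul_nonneg (floorCK_nonneg β ρ τ) (floorTail_nonneg hβ ρ)
  have hM0 : 0 < M := floorMass_pos β μ γ hs0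
  -- the door
  have hpt : ∀ U ∈ B, m * ψ U - r ≤ transferApply β ψ U := by
    intro U hU
    have h := floor_subsolution_tube hL hβ hμ hγ hδ hρ0 hρ hρδ hτ hσ hgap U hU
    rw [hm, hr]
    linarith [h]
  have hdoor := mul_setIntegral_sq_sub_le_levelValue_zero_mul_l2 β hphys (fun U => (floorTrial_pos β μ γ U).le) (fun U => floorTrial_le_one hμ hγ U)
    (measurableSet_torDist_le (L := L) τ) hr0 hpt
  -- the two mass bounds
  have hoff := setIntegral_sq_floorTrial_ge (L := L) (β := β) hμ hγ hτ0
  have hmass := l2_floorTrial_ge (L := L) hβ hμ hγ hs0 hs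
  have hl2pos : 0 < l2 ψ ψ := lt_of_lt_of_le hM0 hmass
  -- `λ₀ ‖ψ‖² ≥ m(‖ψ‖² − e^{−2γτ²}) − r`
  have h1 : m * (l2 ψ ψ - Real.exp (-(2 * γ * τ ^ 2))) - r ≤ levelValue su2Rep L β 0 * l2 ψ ψ := by
    have := mul_le_mul_of_nonneg_left hoff hm0
    linarith
  -- divide by `‖ψ‖² ≥ M`
  have h2 : m - (m * Real.exp (-(2 * γ * τ ^ 2)) + r) / l2 ψ ψ ≤ levelValue su2Rep L β 0 := by
    rw [sub_le_iff_le_add, ← sub_le_iff_le_add', le_div_iff₀ hl2pos]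
    linarith
  have h3 : (m * Real.exp (-(2 * γ * τ ^ 2)) + r) / l2 ψ ψ ≤ (m * Real.exp (-(2 * γ * τ ^ 2)) + r) / M :=
    div_le_div_of_nonneg_left (by positivity) hM0 hmass
  linarith

end Summit.QuantumFields.YangMills.Theorems.FemtoTransferGap

end
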